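import Summits.AtomisticToContinuum.Crystallization.Theorems.ChargedEnergyGapFlatUnit
import Summits.AtomisticToContinuum.Crystallization.Theorems.ChargedEnergyGapCentreBox
import HarnessLib

/-!
(SPLIT FOR THE 400-LINE CAP by the landing lane, hand-2 g49: this file = part A; part B = `…ChargedEnergyGapGridFrame` imports it; same namespace, all FQNs unchanged.)
# ChargedEnergyGap · NODE 113N «GridFrame» — the TOP-LEVEL COVER of the deciding leaf (T¹ᶜ) by framed unit laws, TYPED and PROVED

decomp-a2c lens-3 g96 (imports TREE 113L «FlatUnit» and 113C «CentreBox» only; no new mathematics on the cost side).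

WHY.  Every certificate unit of the D4 programme (113L `ZUnit.soundM`, 113M `TileUnit.sound`, the landed `…ZB*W*` files) lands a FRAME LAW

  `LAW(R, u)`:  for `ρ ∈ [R.rho0, R.rho1]` and every full-normal-form tuple `dt` (chart-realisable, positive, axis-`0` chamber
  `poleSum dt 0 ≤ poleSum dt a`, poles ordered `dt(e_a⁺) ≤ dt(e_a⁻)`) whose six hole-vertex depths lie in the box `[R.lo, R.hi]` and whose centre lies
  in `[R.loC, R.hiC]`:  `feetHoleCost 160 (3/100) ρ dt 0 ≤ domCapK u 160 (3/100) ρ (chargeDepth ρ dt 0)`,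

but the step «the frames cover every admissible tuple, hence (T¹ᶜ)» — the `GridCover` of the D4 architecture — was typed NOWHERE: the tree has
`stencilChartLawQ_of_fullNormalForm` (111 «AxisWLOG») and the unit laws, and nothing in between.  The transverse-tile finding of this generation
(STATUS l.9849: a quarter-tile unit's H-description does not contain the tuples of its nominal cell) is exactly the kind of gap an untyped cover hides.
This node types and proves the cover once and for all, so that the remaining work is a finite list of frame laws BY NAME plus ONE `decide`.

WHAT (all PROVED, no `sorry`, standard axioms).
* §113N.1  the a-priori consequences of the full-normal-form hypotheses in the four PRIMARY COORDINATES `(ρ, T₀, F₀, C)` —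
  `T₀ = dt(e₀⁺)`, `F₀ = dt(e₀⁻)`, `C = dt 0`:  `T₀ ≤ F₀`, `(T₀+F₀+ρ)/2 ≤ C` (113C), `C ≤ T₀ + ρ` (113C) — hence `F₀ ≤ C` —, `187/2 ≤ T₀`,
  `C − ρ < dK`;
  and the TRANSVERSE ENVELOPE of the other four hole vertices in these coordinates: `C − ρ ≤ dt(q) ≤ C + ρ` (Lipschitz), `F_a ≥ (T₀+F₀)/2` (chamber),
  `T_a² ≤ C² + ρ²` (the centre's two rows towards `±e_a` summed: `T_a² + F_a² ≤ 2(C² + ρ²)`, `sq_poles_le_of_chart`).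
* §113N.2  `GBox` (a box in the four coordinates), its sound one-pass CLIPPING by the admissibility rows (`GBox.mem_clip`) and emptiness test.
* §113N.3  `StationRowsCert.coversG R B` (decidable, exact ℚ): the H-description `R` contains every normal-form tuple whose grid point lies in `B`
  (slot `0` and centre by the box, transverse slots by the envelope) — `StationRowsCert.box_of_coversG` (PROVED).
* §113N.4  `GridTree` (BSP over the four coordinates; leaves = frame index | off-domain) and `GridTree.check` (Bool) with `GridTree.check_sound`.
* §113N.5  ★★★ `stencilChartLawQ_of_grid`:  `G.check dK frames (rootBox dK ρlo ρhi) = true` ∧ `(∀ R ∈ frames, LAW(R, u))` ⟹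
  `StencilChartLawQ dK u 160 (3/100) ρlo ρhi`;  the designate `stencilChartLawQ_designate_of_grid` concludes (T¹ᶜ)
  `StencilChartLawQ 130 (1/60000000) 160 (3/100) (679/1000) (691/1000)` BY NAME;  `ZUnit.frameLaw` consumes a landed 113L unit as a frame law.
* §113N.6  LAW-LEVEL TILING `StationRowsCert.law_of_tiles`: a `LawTile` tree over the frame's TRANSVERSE box `(T₁, F₁, T₂, F₂)` whose leaves are
  tile H-descriptions (each at least as wide as the frame off the transverse slots) turns TILE LAWS into the FRAME LAW — so units certified on
  transverse tiles (the landed `ZB2a/ZB2b` T-halves, the `ZB3` quarter tiles) are REUSABLE as tiles, and only the missing (mixed) tiles are new work.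
* §113N.7  `StationRowsCert.frameLaw_swap12`: the law of `R` gives the law of its `1 ↔ 2` mirror `R.swap12` (111 `tupleRelabel 1 0`), so a mixed
  tile `T₁ ∈ I, T₂ ∈ I'` and its mirror cost ONE unit.
* §113N.8  toy checks by `decide +kernel`, including the MUST-FAIL: the landed quarter-tile H-description `ZB3W11L1t0f0.doorR`-shape does NOT cover its
  band box (transverse slots), while the same box with band-wide transverse slots does.

HOW THE PROGRAMME PLUGS IN.  The assembly file lists `frames : List StationRowsCert` (one per unit: its `U.R` / `doorR`), a `GridTree` emitted by the
census scripts (splits on `ρ` = slabs, `T₀`/`F₀` = windows, `C` = centre half-bands; `off` leaves for the clipped-empty corners), proves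
`grid_ok : G.check 130 frames (rootBox 130 (679/1000) (691/1000)) = true` by `decide +kernel`, and discharges `∀ R ∈ frames, LAW(R, 1/60000000)` frame by
frame with the landed `U_law`s (`ZUnit.frameLaw`, or `exact U_law` up to unfolding).  OPEN frames stay hypotheses of the assembled theorem — each one a
named UNDECIDED leaf `LAW(R, 1/60000000)`.

SCOPE NOTE (a-priori domain, PROVED here = what the frames must cover):  `ρ ∈ [ρlo, ρhi]`, `T₀ ∈ [187/2, dK + ρ/2)`, `F₀ ∈ [T₀, C]`,
`C ∈ [(T₀+F₀+ρ)/2, min(T₀ + ρ, dK + ρ))` — for `dK = 130`: `T₀` up to `130.35`, not only the ridge windows `T₀, F₀ ∈ [117.713, 118.913]` of LEDGER v6;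
the bulk (`T₀ < 117.713`) and floor (`T₀ > 118.913`) frames are further leaves of the same grid.
-/

namespace Summit.AtomisticToContinuum.Crystallization.Theorems.ChargedEnergyGapChartDial

open scoped Classical
open Literature.MathematicalPhysics.StatisticalMechanics Literature.Geometry.DiscreteGeometry
open Summit.AtomisticToContinuum.Crystallization.Theses.PricedLinkCensus
open Summit.AtomisticToContinuum.Crystallization.Theorems.ChargedEnergyGapNegative

/-! ## §113N.1 The full-normal-form hypotheses in the four primary coordinates -/
section Apriori

/-- ★ LIPSCHITZ TOWARDS THE CENTRE: every hole vertex is at most `ρ` deeper than the centre (`G(centre, q) = 1`; cf. 113C `centre_upper_of_chart`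
for the other direction `dt 0 ≤ dt q + ρ`). -/
theorem vertex_le_centre_add {ρ : ℝ} (hρ : 0 ≤ ρ) {dt : (Fin 3 → ℤ) → ℝ} (hreal : IsChartRealisable ρ dt) (hC : 0 ≤ dt 0)
    (q : Fin 3 × Bool) : dt (holeVertex 0 q) ≤ dt 0 + ρ := by
  have hG : stG none (some q) ≤ (1 : ℝ) ^ 2 := by
    rw [← cast_stGQ, one_pow, show (1 : ℝ) = ((1 : ℚ) : ℝ) by norm_num, Rat.cast_le]
    obtain ⟨a, s⟩ := q
    fin_cases a <;> cases s <;> decide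
  have h := abs_le_of_chart hreal hρ none (some q) (by simpa using hC) zero_le_one hG
  simp only [stPt_none, stPt_some, mul_one] at h
  exact (le_abs_self _).trans h

/-- ★ THE POLE-PAIR SQUARE ROW at the centre: `T_a² + F_a² ≤ 2·(C² + ρ²)` — the centre's unit-sphere rows towards `+e_a` and `−e_a` summed
(`realisRow_centre_vertex`, 113D); the direction `u` drops out. -/
theorem sq_poles_le_of_chart {ρ : ℝ} {dt : (Fin 3 → ℤ) → ℝ} (hreal : IsChartRealisable ρ dt) (a : Fin 3) :
    dt (holeVertex 0 (a, true)) ^ 2 + dt (holeVertex 0 (a, false)) ^ 2 ≤ 2 * (dt 0 ^ 2 + ρ ^ 2) := by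
  obtain ⟨u, -, hrow⟩ := hreal 0 (mem_stencil_self 0)
  have hT := realisRow_centre_vertex a true (hrow _ (mem_stencil_vertex 0 (a, true)))
  have hF := realisRow_centre_vertex a false (hrow _ (mem_stencil_vertex 0 (a, false)))
  simp only [poleSign, if_true, Bool.false_eq_true, if_false, Int.cast_one, Int.cast_neg, one_mul, neg_mul, mul_neg] at hT hF
  linarith

/-- ★ THE SHALLOW POLE LIES WITHIN `√(C² + ρ²)`: `T_a² ≤ C² + ρ²` for the non-negative, ordered pole pair `0 ≤ T_a ≤ F_a`. -/
theorem sq_pole_true_le {ρ : ℝ} {dt : (Fin 3 → ℤ) → ℝ} (hreal : IsChartRealisable ρ dt) (a : Fin 3)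
    (hT0 : 0 ≤ dt (holeVertex 0 (a, true))) (hTF : dt (holeVertex 0 (a, true)) ≤ dt (holeVertex 0 (a, false))) :
    dt (holeVertex 0 (a, true)) ^ 2 ≤ dt 0 ^ 2 + ρ ^ 2 := by
  have h := sq_poles_le_of_chart hreal a
  have hsq : dt (holeVertex 0 (a, true)) ^ 2 ≤ dt (holeVertex 0 (a, false)) ^ 2 := pow_le_pow_left₀ hT0 hTF 2
  linarith

/-- ★ ADMISSIBLE ⇒ every hole vertex has depth `≥ 187/2` (row `capKRow (hDepthMin) ≥ 1`). -/
theorem vertex_ge_of_hole {dK ρ : ℝ} {dt : (Fin 3 → ℤ) → ℝ} (h : IsTupleHole dK ρ dt) (u : Fin 3 × Bool) :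
    (187 / 2 : ℝ) ≤ dt (holeVertex 0 u) := by
  obtain ⟨hrow, -, -, -⟩ := h
  have hmin : 187 / 2 ≤ hDepthMin dt 0 := by
    by_contra hlt
    rw [not_le] at hlt
    unfold capKRow at hrow
    rw [if_pos hlt] at hrow
    exact absurd hrow (by norm_num)
  exact hmin.trans (Finset.inf'_le _ (Finset.mem_univ u))

/-- ★ ADMISSIBLE ⇒ `C − ρ < dK`: some hole vertex is shallower than `dK` (`hDepthMin < dK`) and the centre is within `ρ` of every vertex (113C). -/
theorem centre_sub_lt_of_hole {dK ρ : ℝ} (hρ : 0 ≤ ρ) {dt : (Fin 3 → ℤ) → ℝ} (h : IsTupleHole dK ρ dt) (hreal : IsChartRealisable ρ dt)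
    (hpos : ∀ p ∈ stencil 0, 0 < dt p) : dt 0 - ρ < dK := by
  obtain ⟨-, -, -, hdK⟩ := h
  obtain ⟨u, -, hu⟩ := Finset.exists_mem_eq_inf' Finset.univ_nonempty (fun u : Fin 3 × Bool => dt (holeVertex 0 u))
  unfold hDepthMin at hdK
  rw [hu] at hdK
  have hc := centre_upper_of_chart hρ hreal u (hpos _ (mem_stencil_vertex 0 u)).le
  linarith

end Apriori

/-! ## §113N.2 Grid boxes in the four primary coordinates and their clipping by the admissibility rows -/
section Boxes

/-- ★ A GRID BOX over the four primary coordinates of a full-normal-form tuple: the frame scale `ρ ∈ [r0, r1]`, the axis-`0` poles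
`T₀ = dt(e₀⁺) ∈ [t0, t1]`, `F₀ = dt(e₀⁻) ∈ [f0, f1]` and the centre `C = dt 0 ∈ [c0, c1]` (exact rationals). -/
structure GBox where
  /-- `ρ` range, low end -/
  r0 : ℚ
  /-- `ρ` range, high end -/
  r1 : ℚ
  /-- `T₀ = dt(e₀⁺)` range, low end -/
  t0 : ℚ
  /-- `T₀` range, high end -/
  t1 : ℚ
  /-- `F₀ = dt(e₀⁻)` range, low end -/
  f0 : ℚ
  /-- `F₀` range, high end -/
  f1 : ℚ
  /-- `C = dt 0` range, low end -/
  c0 : ℚ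
  /-- `C` range, high end -/
  c1 : ℚ

/-- Clipped `T₀` low end: `T₀ ≥ 187/2` (admissible), `T₀ ≥ C − ρ` (Lipschitz). -/
def GBox.cT0 (B : GBox) : ℚ := max B.t0 (max (187 / 2) (B.c0 - B.r1))

/-- Clipped `T₀` high end: `T₀ ≤ F₀` (pole order), `T₀ ≤ C − ρ/2` (centre lower bound with `F₀ ≥ T₀`). -/
def GBox.cT1 (B : GBox) : ℚ := min B.t1 (min B.f1 (B.c1 - B.r0 / 2))

/-- Clipped `F₀` low end: `F₀ ≥ T₀`. -/
def GBox.cF0 (B : GBox) : ℚ := max B.f0 B.cT0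

/-- Clipped `C` low end: `C ≥ (T₀ + F₀ + ρ)/2` (113C `centre_lower_of_box`). -/
def GBox.cC0 (B : GBox) : ℚ := max B.c0 ((B.cT0 + B.cF0 + B.r0) / 2)

/-- Clipped `C` high end: `C ≤ T₀ + ρ` (Lipschitz), `C ≤ dK + ρ` (admissible: `hDepthMin < dK`). -/
def GBox.cC1 (dK : ℚ) (B : GBox) : ℚ := min B.c1 (min (B.cT1 + B.r1) (dK + B.r1))

/-- Clipped `F₀` high end: `F₀ ≤ C` (from `C ≥ (T₀ + F₀ + ρ)/2` and `C ≤ T₀ + ρ`: the deep axis-`0` pole is never deeper than the centre). -/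
def GBox.cF1 (dK : ℚ) (B : GBox) : ℚ := min B.f1 (B.cC1 dK)

/-- ★ ONE-PASS CLIPPING of a grid box by the admissibility rows (sound: `GBox.mem_clip`; the `ρ` range is kept). -/
def GBox.clip (dK : ℚ) (B : GBox) : GBox := ⟨B.r0, B.r1, B.cT0, B.cT1, B.cF0, B.cF1 dK, B.cC0, B.cC1 dK⟩

/-- ★ EMPTINESS TEST: some coordinate range of the box is empty. -/
def GBox.isEmpty (B : GBox) : Bool := decide (B.r1 < B.r0 ∨ B.t1 < B.t0 ∨ B.f1 < B.f0 ∨ B.c1 < B.c0)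

/-- ★★ CLIPPING IS SOUND: a point of `B` satisfying the admissibility rows lies in `B.clip dK`. -/
theorem GBox.mem_clip (dK : ℚ) (B : GBox) {ρ T F C : ℝ}
    (hTF : T ≤ F) (hClo : (T + F + ρ) / 2 ≤ C) (hChi : C ≤ T + ρ) (hT935 : (187 / 2 : ℝ) ≤ T) (hCdK : C - ρ < dK)
    (h : (B.r0 : ℝ) ≤ ρ ∧ ρ ≤ B.r1 ∧ (B.t0 : ℝ) ≤ T ∧ T ≤ B.t1 ∧ (B.f0 : ℝ) ≤ F ∧ F ≤ B.f1 ∧ (B.c0 : ℝ) ≤ C ∧ C ≤ B.c1) :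
    ((B.clip dK).r0 : ℝ) ≤ ρ ∧ ρ ≤ (B.clip dK).r1 ∧ ((B.clip dK).t0 : ℝ) ≤ T ∧ T ≤ (B.clip dK).t1 ∧
      ((B.clip dK).f0 : ℝ) ≤ F ∧ F ≤ (B.clip dK).f1 ∧ ((B.clip dK).c0 : ℝ) ≤ C ∧ C ≤ (B.clip dK).c1 := by
  obtain ⟨hr0, hr1, ht0, ht1, hf0, hf1, hc0, hc1⟩ := h
  have eT0 : (B.cT0 : ℝ) ≤ T := by
    simp only [GBox.cT0]; push_cast
    exact max_le ht0 (max_le hT935 (by linarith))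
  have eT1 : T ≤ (B.cT1 : ℝ) := by
    simp only [GBox.cT1]; push_cast
    exact le_min ht1 (le_min (hTF.trans hf1) (by linarith))
  have eF0 : (B.cF0 : ℝ) ≤ F := by
    simp only [GBox.cF0]; push_cast
    exact max_le hf0 (eT0.trans hTF)
  have eC0 : (B.cC0 : ℝ) ≤ C := by
    simp only [GBox.cC0]; push_cast
    exact max_le hc0 (by linarith)
  have eC1 : C ≤ (B.cC1 dK : ℝ) := by
    simp only [GBox.cC1]; push_cast
    exact le_min hc1 (le_min (by linarith) (by linarith))
  have eF1 : F ≤ (B.cF1 dK : ℝ) := by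
    simp only [GBox.cF1]; push_cast
    exact le_min hf1 (by linarith)
  exact ⟨hr0, hr1, eT0, eT1, eF0, eF1, eC0, eC1⟩

/-- ★ AN EMPTY BOX HAS NO POINTS. -/
theorem GBox.not_mem_of_isEmpty {B : GBox} (h : B.isEmpty = true) {ρ T F C : ℝ}
    (hm : (B.r0 : ℝ) ≤ ρ ∧ ρ ≤ B.r1 ∧ (B.t0 : ℝ) ≤ T ∧ T ≤ B.t1 ∧ (B.f0 : ℝ) ≤ F ∧ F ≤ B.f1 ∧ (B.c0 : ℝ) ≤ C ∧ C ≤ B.c1) : False := by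
  obtain ⟨hr0, hr1, ht0, ht1, hf0, hf1, hc0, hc1⟩ := hm
  simp only [GBox.isEmpty, decide_eq_true_eq] at h
  rcases h with h | h | h | h
  · have h' : ((B.r1 : ℚ) : ℝ) < B.r0 := by exact_mod_cast h
    linarith
  · have h' : ((B.t1 : ℚ) : ℝ) < B.t0 := by exact_mod_cast h
    linarith
  · have h' : ((B.f1 : ℚ) : ℝ) < B.f0 := by exact_mod_cast h
    linarith
  · have h' : ((B.c1 : ℚ) : ℝ) < B.c0 := by exact_mod_cast h
    linarith

end Boxes

/-! ## §113N.3 Frames: an H-description contains the tuples of a grid box -/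
section Frames

/-- ★ FRAME CONTAINMENT (decidable, exact ℚ): the H-description `R` (ρ-slab × six-slot hole-vertex box × centre band) contains every full-normal-form
tuple whose grid point `(ρ, T₀, F₀, C)` lies in `B`: slot `0` and the centre by the box itself; each TRANSVERSE slot `(a, ±)`, `a = 1, 2`, by the
envelope — `T_a, F_a ≥ C − ρ ≥ c0 − r1`, `F_a ≤ C + ρ ≤ c1 + r1`, `T_a ≤ F_a ≤ c1 + r1` or `T_a ≤ √(C² + ρ²) ≤ hi` (tested as `c1² + r1² ≤ hi²`,
`hi ≥ 0`), and `F_a ≥ (T₀ + F₀)/2 ≥ (t0 + f0)/2` (chamber). -/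
def StationRowsCert.coversG (R : StationRowsCert) (B : GBox) : Bool :=
  decide (R.rho0 ≤ B.r0 ∧ B.r1 ≤ R.rho1 ∧ R.lo (0, true) ≤ B.t0 ∧ B.t1 ≤ R.hi (0, true) ∧ R.lo (0, false) ≤ B.f0 ∧ B.f1 ≤ R.hi (0, false) ∧
      R.loC ≤ B.c0 ∧ B.c1 ≤ R.hiC ∧ 0 ≤ B.c0) &&
    [(1 : Fin 3), 2].all fun a =>
      decide (R.lo (a, true) ≤ B.c0 - B.r1 ∧ (B.c1 + B.r1 ≤ R.hi (a, true) ∨ (0 ≤ R.hi (a, true) ∧ B.c1 ^ 2 + B.r1 ^ 2 ≤ R.hi (a, true) ^ 2)) ∧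
        (R.lo (a, false) ≤ B.c0 - B.r1 ∨ 2 * R.lo (a, false) ≤ B.t0 + B.f0) ∧ B.c1 + B.r1 ≤ R.hi (a, false))

/-- ★★ FRAME CONTAINMENT IS SOUND: if `R.coversG B`, every full-normal-form tuple with grid point in `B` satisfies the slab, six-slot box and centre
hypotheses of the frame law `LAW(R, ·)` (the binders of 113L `ZUnit.soundM` / 113M `TileUnit.sound`). -/
theorem StationRowsCert.box_of_coversG {R : StationRowsCert} {B : GBox} (h : R.coversG B = true) {ρ : ℝ} (hρ : 0 ≤ ρ)
    {dt : (Fin 3 → ℤ) → ℝ} (hreal : IsChartRealisable ρ dt) (hpos : ∀ p ∈ stencil 0, 0 < dt p)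
    (hch1 : poleSum dt 0 ≤ poleSum dt 1) (hch2 : poleSum dt 0 ≤ poleSum dt 2)
    (hchp : ∀ a : Fin 3, dt (holeVertex 0 (a, true)) ≤ dt (holeVertex 0 (a, false)))
    (hm : (B.r0 : ℝ) ≤ ρ ∧ ρ ≤ B.r1 ∧ (B.t0 : ℝ) ≤ dt (holeVertex 0 (0, true)) ∧ dt (holeVertex 0 (0, true)) ≤ B.t1 ∧
      (B.f0 : ℝ) ≤ dt (holeVertex 0 (0, false)) ∧ dt (holeVertex 0 (0, false)) ≤ B.f1 ∧ (B.c0 : ℝ) ≤ dt 0 ∧ dt 0 ≤ B.c1) :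
    ((R.rho0 : ℝ) ≤ ρ ∧ ρ ≤ R.rho1) ∧ (∀ q, castW R.lo q ≤ dt (holeVertex 0 q) ∧ dt (holeVertex 0 q) ≤ castW R.hi q) ∧
      ((R.loC : ℝ) ≤ dt 0 ∧ dt 0 ≤ R.hiC) := by
  obtain ⟨hr0, hr1, ht0, ht1, hf0, hf1, hc0, hc1⟩ := hm
  simp only [StationRowsCert.coversG, Bool.and_eq_true, decide_eq_true_eq, List.all_cons, List.all_nil, Bool.and_true] at h
  obtain ⟨⟨hρ0, hρ1, hl0T, hh0T, hl0F, hh0F, hlC, hhC, -⟩, h1, h2⟩ := h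
  have hC : 0 ≤ dt 0 := (hpos 0 (mem_stencil_self 0)).le
  have hlo : ∀ q, dt 0 - ρ ≤ dt (holeVertex 0 q) := fun q => by
    have := centre_upper_of_chart hρ hreal q (hpos _ (mem_stencil_vertex 0 q)).le
    linarith
  have hhi : ∀ q, dt (holeVertex 0 q) ≤ dt 0 + ρ := fun q => vertex_le_centre_add hρ hreal hC q
  -- the two transverse axes
  have haxis : ∀ a : Fin 3, poleSum dt 0 ≤ poleSum dt a →
      (R.lo (a, true) ≤ B.c0 - B.r1 ∧ (B.c1 + B.r1 ≤ R.hi (a, true) ∨ (0 ≤ R.hi (a, true) ∧ B.c1 ^ 2 + B.r1 ^ 2 ≤ R.hi (a, true) ^ 2)) ∧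
        (R.lo (a, false) ≤ B.c0 - B.r1 ∨ 2 * R.lo (a, false) ≤ B.t0 + B.f0) ∧ B.c1 + B.r1 ≤ R.hi (a, false)) →
      (((R.lo (a, true) : ℚ) : ℝ) ≤ dt (holeVertex 0 (a, true)) ∧ dt (holeVertex 0 (a, true)) ≤ ((R.hi (a, true) : ℚ) : ℝ)) ∧
      (((R.lo (a, false) : ℚ) : ℝ) ≤ dt (holeVertex 0 (a, false)) ∧ dt (holeVertex 0 (a, false)) ≤ ((R.hi (a, false) : ℚ) : ℝ)) := by
    rintro a ha ⟨hlT, hhT, hlF, hhF⟩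
    have e1 := hlo (a, true)
    have e2 := hhi (a, false)
    have e3 := hlo (a, false)
    have ep := hchp a
    refine ⟨⟨?_, ?_⟩, ?_, ?_⟩
    · have h' : ((R.lo (a, true) : ℚ) : ℝ) ≤ (B.c0 : ℝ) - B.r1 := by exact_mod_cast hlT
      linarith
    · rcases hhT with hhT | ⟨hnn, hsq⟩
      · have h' : (B.c1 : ℝ) + B.r1 ≤ ((R.hi (a, true) : ℚ) : ℝ) := by exact_mod_cast hhT
        linarith
      · have hsq' : (B.c1 : ℝ) ^ 2 + (B.r1 : ℝ) ^ 2 ≤ ((R.hi (a, true) : ℚ) : ℝ) ^ 2 := by exact_mod_cast hsq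
        have hnn' : (0 : ℝ) ≤ ((R.hi (a, true) : ℚ) : ℝ) := by exact_mod_cast hnn
        have hCsq : dt 0 ^ 2 ≤ (B.c1 : ℝ) ^ 2 := pow_le_pow_left₀ hC hc1 2
        have hρsq : ρ ^ 2 ≤ (B.r1 : ℝ) ^ 2 := pow_le_pow_left₀ hρ hr1 2
        have hT := sq_pole_true_le hreal a (hpos _ (mem_stencil_vertex 0 (a, true))).le ep
        have h2 : dt (holeVertex 0 (a, true)) ^ 2 ≤ ((R.hi (a, true) : ℚ) : ℝ) ^ 2 := by linarith
        exact (abs_le_of_sq_le_sq' h2 hnn').2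
    · rcases hlF with hlF | hlF
      · have h' : ((R.lo (a, false) : ℚ) : ℝ) ≤ (B.c0 : ℝ) - B.r1 := by exact_mod_cast hlF
        linarith
      · have h' : 2 * ((R.lo (a, false) : ℚ) : ℝ) ≤ (B.t0 : ℝ) + B.f0 := by exact_mod_cast hlF
        unfold poleSum at ha
        linarith
    · have h' : (B.c1 : ℝ) + B.r1 ≤ ((R.hi (a, false) : ℚ) : ℝ) := by exact_mod_cast hhF
      linarith
  obtain ⟨h1T, h1F⟩ := haxis 1 hch1 h1
  obtain ⟨h2T, h2F⟩ := haxis 2 hch2 h2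
  have hs0 : ((R.rho0 : ℚ) : ℝ) ≤ (B.r0 : ℝ) := by exact_mod_cast hρ0
  have hs1 : (B.r1 : ℝ) ≤ ((R.rho1 : ℚ) : ℝ) := by exact_mod_cast hρ1
  have g0T : ((R.lo (0, true) : ℚ) : ℝ) ≤ (B.t0 : ℝ) := by exact_mod_cast hl0T
  have g1T : (B.t1 : ℝ) ≤ ((R.hi (0, true) : ℚ) : ℝ) := by exact_mod_cast hh0T
  have g0F : ((R.lo (0, false) : ℚ) : ℝ) ≤ (B.f0 : ℝ) := by exact_mod_cast hl0F
  have g1F : (B.f1 : ℝ) ≤ ((R.hi (0, false) : ℚ) : ℝ) := by exact_mod_cast hh0F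
  have gC0 : ((R.loC : ℚ) : ℝ) ≤ (B.c0 : ℝ) := by exact_mod_cast hlC
  have gC1 : (B.c1 : ℝ) ≤ ((R.hiC : ℚ) : ℝ) := by exact_mod_cast hhC
  refine ⟨⟨hs0.trans hr0, hr1.trans hs1⟩, ?_, ⟨gC0.trans hc0, hc1.trans gC1⟩⟩
  rintro ⟨a, b⟩
  simp only [castW_apply]
  have ha : a = 0 ∨ a = 1 ∨ a = 2 := by fin_cases a <;> simp
  rcases ha with rfl | rfl | rfl <;> cases b
  · exact ⟨g0F.trans hf0, hf1.trans g1F⟩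
  · exact ⟨g0T.trans ht0, ht1.trans g1T⟩
  · exact h1F
  · exact h1T
  · exact h2F
  · exact h2T

end Frames

/-! ## §113N.4 Grid trees: a BSP of the four-coordinate root box into frames and off-domain corners -/
section Grid

/-- ★ A GRID TREE: binary space partition of a `GBox` along the four primary coordinates; a leaf is either a frame index (into the frame list)
or `off` (the clipped box is empty: no admissible tuple there). -/
inductive GridTree where
  /-- leaf: the (clipped) box is contained in the H-description `frames[j]` -/
  | frame (j : ℕ)
  /-- leaf: the clipped box is empty -/
  | off
  /-- split the `ρ` range at `m` -/
  | splitR (m : ℚ) (tlo thi : GridTree)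
  /-- split the `T₀` range at `m` -/
  | splitT (m : ℚ) (tlo thi : GridTree)
  /-- split the `F₀` range at `m` -/
  | splitF (m : ℚ) (tlo thi : GridTree)
  /-- split the `C` range at `m` -/
  | splitC (m : ℚ) (tlo thi : GridTree)

/-- ★ THE GRID CHECKER (Bool, exact ℚ; `decide +kernel`): every leaf box, clipped by the admissibility rows, is covered by its frame or empty. -/
def GridTree.check (dK : ℚ) (frames : List StationRowsCert) : GridTree → GBox → Bool
  | .frame j, B =>
    match frames[j]? with
    | some R => R.coversG (B.clip dK)
    | none => false
  | .off, B => (B.clip dK).isEmpty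
  | .splitR m tlo thi, B => tlo.check dK frames { B with r1 := m } && thi.check dK frames { B with r0 := m }
  | .splitT m tlo thi, B => tlo.check dK frames { B with t1 := m } && thi.check dK frames { B with t0 := m }
  | .splitF m tlo thi, B => tlo.check dK frames { B with f1 := m } && thi.check dK frames { B with f0 := m }
  | .splitC m tlo thi, B => tlo.check dK frames { B with c1 := m } && thi.check dK frames { B with c0 := m }

/-- ★★ THE GRID CHECKER IS SOUND: an admissible point of a checked box lies in a box covered by one of the frames. -/
theorem GridTree.check_sound (dK : ℚ) (frames : List StationRowsCert) {ρ T F C : ℝ}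
    (hTF : T ≤ F) (hClo : (T + F + ρ) / 2 ≤ C) (hChi : C ≤ T + ρ) (hT935 : (187 / 2 : ℝ) ≤ T) (hCdK : C - ρ < dK) :
    ∀ (t : GridTree) (B : GBox), t.check dK frames B = true →
      ((B.r0 : ℝ) ≤ ρ ∧ ρ ≤ B.r1 ∧ (B.t0 : ℝ) ≤ T ∧ T ≤ B.t1 ∧ (B.f0 : ℝ) ≤ F ∧ F ≤ B.f1 ∧ (B.c0 : ℝ) ≤ C ∧ C ≤ B.c1) →
      ∃ R ∈ frames, ∃ B' : GBox, R.coversG B' = true ∧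
        ((B'.r0 : ℝ) ≤ ρ ∧ ρ ≤ B'.r1 ∧ (B'.t0 : ℝ) ≤ T ∧ T ≤ B'.t1 ∧ (B'.f0 : ℝ) ≤ F ∧ F ≤ B'.f1 ∧ (B'.c0 : ℝ) ≤ C ∧ C ≤ B'.c1) := by
  intro t
  induction t with
  | frame j =>
    intro B h hm
    simp only [GridTree.check] at h
    split at h
    · next R hR => exact ⟨R, List.mem_of_getElem? hR, _, h, B.mem_clip dK hTF hClo hChi hT935 hCdK hm⟩
    · exact absurd h Bool.false_ne_true
  | off =>
    intro B h hm
    exact (GBox.not_mem_of_isEmpty h (B.mem_clip dK hTF hClo hChi hT935 hCdK hm)).elim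
  | splitR m tlo thi ihlo ihhi =>
    intro B h hm
    simp only [GridTree.check, Bool.and_eq_true] at h
    obtain ⟨hr0, hr1, ht0, ht1, hf0, hf1, hc0, hc1⟩ := hm
    rcases le_total ρ (m : ℝ) with hle | hle
    · exact ihlo _ h.1 ⟨hr0, hle, ht0, ht1, hf0, hf1, hc0, hc1⟩
    · exact ihhi _ h.2 ⟨hle, hr1, ht0, ht1, hf0, hf1, hc0, hc1⟩
  | splitT m tlo thi ihlo ihhi =>
    intro B h hm
    simp only [GridTree.check, Bool.and_eq_true] at h
    obtain ⟨hr0, hr1, ht0, ht1, hf0, hf1, hc0, hc1⟩ := hm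
    rcases le_total T (m : ℝ) with hle | hle
    · exact ihlo _ h.1 ⟨hr0, hr1, ht0, hle, hf0, hf1, hc0, hc1⟩
    · exact ihhi _ h.2 ⟨hr0, hr1, hle, ht1, hf0, hf1, hc0, hc1⟩
  | splitF m tlo thi ihlo ihhi =>
    intro B h hm
    simp only [GridTree.check, Bool.and_eq_true] at h
    obtain ⟨hr0, hr1, ht0, ht1, hf0, hf1, hc0, hc1⟩ := hm
    rcases le_total F (m : ℝ) with hle | hle
    · exact ihlo _ h.1 ⟨hr0, hr1, ht0, ht1, hf0, hle, hc0, hc1⟩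
    · exact ihhi _ h.2 ⟨hr0, hr1, ht0, ht1, hle, hf1, hc0, hc1⟩
  | splitC m tlo thi ihlo ihhi =>
    intro B h hm
    simp only [GridTree.check, Bool.and_eq_true] at h
    obtain ⟨hr0, hr1, ht0, ht1, hf0, hf1, hc0, hc1⟩ := hm
    rcases le_total C (m : ℝ) with hle | hle
    · exact ihlo _ h.1 ⟨hr0, hr1, ht0, ht1, hf0, hf1, hc0, hle⟩
    · exact ihhi _ h.2 ⟨hr0, hr1, ht0, ht1, hf0, hf1, hle, hc1⟩

end Grid

end Summit.AtomisticToContinuum.Crystallization.Theorems.ChargedEnergyGapChartDial
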